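import Mathlib
import HarnessLib
import HarnessLib.Audit
import Summits.ValiantsHypothesis.Statement
import Literature.Computability.AlgebraicComplexity.TavenasHutchinsonFamily
import Literature.Computability.AlgebraicComplexity.ValiantConjectureEquivProofs
import Summits.ValiantsHypothesis.ValiantsHypothesis.Theorems.SymmetroidDescartesThetaPencilWitnessTheta
import HarnessLib.Audit.Status.Attr

/-!
Route: RealTau

DORMANT since 2026-08-29T19:43:32Z (census g0: costume|duplicate of —; reader census-reader-27-g0) — unstaffed, not closed; items shared with open routes are served there. `ledger route dormant <id> --off` reactivates.

# Route RealTau — real zeros below Descartes for sums of products of sparse polynomials, fed to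
Tavenas' all-real-rooted V_n — VP ≠ VNP with constants free

RESURRECT LENS (2001 pnp/routes/real-tau-and-sos-hardness, form (R); TauConst's recommended sibling
`RealTau`, never opened).
It suffices to show X = X1 ∧ X2. X1 (crux `RealTauRefined`) is Tavenas' REFINED REAL τ-CONJECTURE
(Tavenas2014 Conj. 3.23,
p. 48): a nonzero F = Σ_{i<k} Π_{j<m} f_ij with real t-sparse f_ij has at most 2^{a(m+1)}·(k+t+2)^a
distinct real zeros for one
absolute a ("polynomial in k, t, 2^m" — strictly weaker than Koiran's poly(kmt) form =
TauConst.TauReal, and exactly Descartes'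
count 2k·t^m with the exponent m moved off t). X2 (crux `RealVnTransfer`) is the with-constants
sparse-depth-four transfer for
Tavenas' P-definable family V_n = Σ_{i<2^n} 2^{2i(2^n−1−i)} X^i, ALL of whose 2^n − 1 roots are real
(Hutchinson/Kurtz; tree
`card_roots_toFinset_map_tavenasV`): if per is p-computable over ℂ then every V_n is, over ℝ, a
ΣΠ-sparse expression with
k, t ≤ (n+2)^{C(⌊√(2n+3)⌋+1)}, m ≤ C(⌊√(2n+3)⌋+1) (Tavenas2014 Thm 3.38 = Cor. 3.37 + Prop. 3.21 +
realification; the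
constant-free version is PROVED in the tree, `exists_sps_of_isProjection_perPoly`). X1 ∧ X2
contradict at n = 4^j: 2^n − 1 ≤
2^{a(m+1)}(k+t+2)^a ≤ (n+2)^{O(√n)} < 2^n. Target item `VnSparseHard` = the weakest V_n-specific
statement the contradiction
needs (infinitely often V_n is not ΣΠ-sparse of Tavenas size). No card realised (sibling card
lacunary-symmetroid-descartes is a
different reduction, see Novelty).
Lean: `(∃ a : ℕ, ∀ (k m t : ℕ) (f : Fin k → Fin m → Polynomial ℝ), (∀ i j, (f i j).support.card ≤ t)
→ (∑ i, ∏ j, f i j) ≠ 0 → (∑ i, ∏ j, f i j).roots.toFinset.card ≤ 2 ^ (a * (m + 1)) * (k + t + 2) ^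
a) ∧ (Literature.Computability.AlgebraicComplexity.IsPComputable (fun n =>
Literature.Computability.AlgebraicComplexity.perPoly (Fin n) ℂ) → ∃ C : ℕ, ∀ n : ℕ, ∃ (k m t : ℕ) (g
: Fin k → Fin m → Polynomial ℝ), k ≤ (n + 2) ^ (C * (Nat.sqrt (2 * n + 3) + 1)) ∧ m ≤ C * (Nat.sqrt
(2 * n + 3) + 1) ∧ t ≤ (n + 2) ^ (C * (Nat.sqrt (2 * n + 3) + 1)) ∧ (∀ i j, (g i j).support.card ≤
t) ∧ (∑ i, ∏ j, g i j) = (Literature.Computability.AlgebraicComplexity.tavenasV n).map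
(Int.castRingHom ℝ))`

## Assembly
By contradiction, pure arithmetic over PROVED tree theorems plus Mathlib (deciding theorem `closes`,
~130 lines, certified
natively; cone repair 2026-08-17, rev 1): `ValiantsHypothesis` unfolds to VP ℂ ≠ VNP ℂ;
`perNotPComputableComplex_iff_holds`
(ValiantConjectureEquivProofs) turns VP ℂ = VNP ℂ into p-computability of per over ℂ; RealVnTransfer
then writes every V_n as a
real ΣΠ-sparse expression of Tavenas size C; RealTauRefined bounds its real zeros by
2^{a(m+1)}(k+t+2)^a ≤ (n+2)^{a(2C+3)(⌊√(2n+3)⌋+4)};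
`le_card_roots_toFinset_map_tavenasV` / `map_tavenasV_ne_zero` (TavenasHutchinsonFamily) supply 2^n
− 1 real zeros of V_n ≠ 0; the
growth step "(n+2)^{A(⌊√(2n+3)⌋+4)} < 2^n for some n = 4^j" is proved INLINE in `closes` from
Mathlib's
`tendsto_pow_const_div_const_pow_of_one_lt` (same statement as the tree's
`exists_pow_sqrt_lt_two_pow`, which is deliberately NOT
imported: its home module `RealTauConjectureProofs` drags `TauConjecture.lean` — the OPEN
conjectures `KoiranRealTauConjecture` and
`ShubSmaleTauConjecture` — into the route's import cone although no item or proof here uses them).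
Route imports are exactly
TavenasHutchinsonFamily + ValiantConjectureEquivProofs (+ Mathlib, HarnessLib, the Statement);
provers of the support items should
likewise take the growth lemma from Mathlib (or copy the inline argument) rather than import the
TauConjecture chain.
The Assembly item records the target form (VnSparseHard → RealVnTransfer → VH, proved in Sketch.lean
`assembly_proof`).

Rationale: WHY THIS LINE. The ORDER of ℝ is the one structure no open route of the summit uses:
Descartes'/Pólya–Szegő sign rules, Rolle and the
Voorhoeve–van der Poorten–KPT Wronskian inequality (KoiranPortierTavenas2015 Thm 9/12),
Khovanskii–Bihan–Sottile fewnomial bounds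
and Kac–Rice average-case counting (BriquelBurgisser2020: the real τ-conjecture is true on average)
are tools of real algebraic
geometry with no circuit in them, and Koiran2011 §6 / Tavenas2014 Ch. 3 turn any sub-Descartes
real-zero bound for ΣΠ-sparse
expressions into per ∉ VP_ℂ. The constant problem that stalls TauConst (TauConstElim) and every
Boolean-transfer route is absent:
real zeros ignore coefficient size, and Tavenas' V_n (Bit(V) ∈ P, VNP-lift a projection of PER —
discharged in the tree,
`TavenasVnWitness`) replaces Pochhammer–Wilkinson, so neither GRH nor the counting hierarchy enters
(Tavenas2014 Thm 3.38;
Burgisser2024Completeness §4.6 Conj. 4.1). Versus the listed routes: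
NewtonFrames/NewtonUnitEquations count Newton vertices over ℂ
(KoiranEtAl2014; real τ ⇒ Newton τ by Hrubeš, so X1 is the archimedean twin with Rolle available),
FeketeSOS counts p-adic
multiplicity at depth 2 (Dutta2021's SOS-τ is the depth-2 real cousin, same witness family),
TauConst counts integer zeros and
carries TauReal only as unranked decoration. Imported area: real fewnomial theory / o-minimal
counting; nothing from GCT or rank.

RANKED CRUXES. #0 VnSparseHard (target) — infinitely often in n, Tavenas' V_n is NOT a real sum of k
products of m t-sparse polynomials with k, t ≤ (n+2)^{C(⌊√(2n+3)⌋+1)}, m ≤ C(⌊√(2n+3)⌋+1), for every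
C — an explicit sparse-depth-four lower bound for one all-real-rooted P-definable family (weakest
V_n-specific statement the deciding theorem consumes; implied by RealTauRefined, support
RefinedImpliesHard). (why it might fail: V_n's multilinear lift is a rank-one Ising partition
function Σ_σ 4^{-(Σ 2^j σ_j)²}·(monomials); a Hubbard–Stratonovich/Gauss-sum identity with poly(n)
nodes would put it in VP and give exactly such representations.) [Tavenas2014, Dutta2021, Kurtz1992,
Hutchinson1923]
#2 RealTauRefined (crux) — Tavenas' refined real τ-conjecture (Conj. 3.23): the number of distinct
real zeros of a nonzero Σ_{i<k}Π_{j<m} f_ij, f_ij ∈ ℝ[X] t-sparse, is ≤ 2^{a(m+1)}(k+t+2)^a for an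
absolute a — "beat Descartes' 2k·t^m by decoupling m from t"; equivalent (Lemme 3.26, Fischer) to
the refined powers form Σ c_i f_i^{α_i} (the antecedent of support PowersImpliesRefined since rev 2;
the separate item RealTauPowers was dropped as outside the cone of `closes`); implied by Koiran's
form TauReal (support OfKoiran, proved in Sketch). [difficulty: open-problem] (why it might fail: No
tool beats Descartes once k ≥ 2: Wronskians give t^{O(mk²)} (KPT15 Thm 12), fewnomials
2^{O((kmt)²)}; even Z(fg+1)=O(t) is open (Chattopadhyay/Koiran/Dutta); one ΣΠ-sparse family with
t^{Ω(m)} real zeros, or V_n's lift in VP, kills it.) [Tavenas2014, Koiran2011,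
KoiranPortierTavenas2015, BriquelBurgisser2020, Burgisser2024Completeness, Dutta2021,
arXiv:1107.1434]
#3 RealVnTransfer (crux) — with-constants Koiran–Tavenas transfer for V_n (Tavenas2014 Thm 3.38 via
Cor. 3.37 and Prop. 3.21): if (per_n) is p-computable over ℂ then for some C every V_n equals, in
ℝ[X], a sum of k ≤ (n+2)^{C(⌊√(2n+3)⌋+1)} products of m ≤ C(⌊√(2n+3)⌋+1) polynomials with ≤
(n+2)^{C(⌊√(2n+3)⌋+1)} monomials — realification of constants + the tree's PROVED constant-free
depth-four route re-run over ℝ. A consequence of VH (vacuous antecedent) used toward VH.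
[difficulty: L] (why it might fail: Published but unformalised: needs per ∈ VP_ℂ ⇒ per ∈ VP_ℝ
(realification of weighted-sum gates, in neither tree nor thesis text) and the tree's depth-4
reduction re-run for `complexity` over ℝ; a shape mismatch in the exponent C(⌊√(2n+3)⌋+1) forces a
restatement.) [Tavenas2014, Koiran2011,
Literature.Computability.AlgebraicComplexity.exists_sps_of_isProjection_perPoly,
Literature.Computability.AlgebraicComplexity.Tavenas2014_cor_3_37]
#9 PowersImpliesRefined (support) — SELF-CONTAINED since rev 2 (unused-crux repair 2026-08-17): IF
the refined real τ-bound WITH POWERS holds (Tavenas2014 Conj. 3.24 with signed coefficients: a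
nonzero Σ_{i<k} c_i f_i^{α_i}, f_i t-sparse, α_i ≤ m, has ≤ 2^{a(m+1)}(k+t+2)^a distinct real zeros
for one absolute a — the normal form in which Wronskian factorisation applies, one sparse polynomial
per term; formerly the separate item RealTauPowers, auto-cruxed and then dropped at rev 2 because
`closes` never touches it: it is a LINE on RealTauRefined, cf. the birth skeleton stub_powers +
stub_fischer attached to that item) THEN RealTauRefined, by the Fischer/polarisation step of
Tavenas' Lemme 3.26: m!·Π_{j<m} y_j = Σ_{S⊆[m]} (−1)^{m−|S|}(Σ_{j∈S} y_j)^m turns a ΣΠ of k products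
of m t-sparse polynomials into a signed sum of k·2^m m-th powers of (mt)-sparse polynomials; the
bound re-absorbs with a' = 3a. A proof of the powers form thus still closes the rank-2 crux through
this item. [difficulty: M] [Tavenas2014, KoiranPortierTavenas2015]
#9 TauReal (support) — Koiran's real τ-conjecture, bound polynomial in k, m, t (Koiran2011 §6 Conj.
3) — SHARED by signature with route TauConst (item TauReal, stmt-ValiantsHypothesis-0358, rank 4
there and not in its deciding theorem); here the stronger printed form whose proof closes
RealTauRefined via OfKoiran. [difficulty: open-problem] [Koiran2011, Tavenas2014,
Burgisser2024Completeness]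
#9 OfKoiran (support) — Koiran's form implies Tavenas' refined form ((k+m+t+2)^c ≤
2^{c(m+1)}(k+t+2)^c) — PROVED in the planner's Sketch.lean (`ofKoiran_proof`, 8 lines); lands with
the route's first Theorems file. [difficulty: provable-now] [Tavenas2014]
#9 Realification (support) — p-computability of (per_n) over ℂ implies p-computability over ℝ
(simulate each complex weighted-sum / product gate by O(1) real gates on real and imaginary parts;
per_n has real coefficients) — the first half of RealVnTransfer. [difficulty: M] [Burgisser2000,
Tavenas2014]
#9 RefinedImpliesHard (support) — the refined real τ-conjecture gives the target: any ΣΠ-sparse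
expression of Tavenas size C at level n has ≤ (n+2)^{a(2C+3)(⌊√(2n+3)⌋+4)} real zeros, fewer than
V_n's 2^n − 1 for infinitely many n (the growth step of `closes` — proved there inline from Mathlib,
statement of the tree's `exists_pow_sqrt_lt_two_pow` — strengthened to arbitrarily large n; prove it
from Mathlib as `closes` does, do not import `RealTauConjectureProofs`, whose import cone carries
the open τ-conjectures). [difficulty: provable-now] [Tavenas2014]

TWO-LAYER PLAN. Foreseen, not filed: RealTauRefined ⇐ GenericScales → CancellingScales →
RealTauRefined (k = 2, depth 1): GenericScales (provable,
M/L) = at every dyadic scale where the archimedean tropicalisation max_i Σ_j trop(f_ij) is attained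
by ONE product with margin
> log₂(2kt^m), F has no real zero (first lemma `DominantTermSign` typed in Sketch.lean);
CancellingScales (the open core) = the
number of dyadic scales carrying parallel/tied leading products AND a zero of F is ≤
2^{O(m)}poly(kt) — against V_n, whose zeros
occupy 2^n − 1 disjoint 4-scale blocks (ratio 16), a SCALE-COUNT bound already suffices.
RealVnTransfer ⇐ Realification →
RealSparseDepthFour (its two birth stubs). Second entry kept in reserve (sibling route, not an item
here): Dutta2021 Conj. 1
(SOS-τ: Z_ℝ(Σ c_i g_i²) ≤ c·Σ|supp g_i|, true for ≤ 2 squares, Thm 9) with the SAME witness family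
(Dutta2021 Thm 2 uses
f_d = Σ 2^{2i(d−i)}x^i) and DST magnification in place of depth reduction — the depth-2 twin of X1;
FeketeSOS's kill criterion (v)
names exactly this supersession.

KILL CRITERIA. (i) An explicit ΣΠ-sparse family with more than 2^{a(m+1)}(k+t+2)^a distinct real
zeros for every a (e.g. t^{Ω(m)} zeros at k = 2;
at bounded m Descartes forbids it, so the danger is m-growth) refutes RealTauRefined — close
`refuted:RealTauRefined`; the family
also refutes TauConst.TauReal and Koiran's conjecture and goes to the negatives index and to
Literature/Barriers next to
TauRealZeros. (ii) A polynomial-size circuit family for V_n's multilinear lift h_n (a VP upper bound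
for the rank-one Ising/theta
lift) refutes VnSparseHard AND RealTauRefined unconditionally (the transfer's depth-4 step is a
theorem) — same close.
(iii) RealVnTransfer cannot be refuted short of ¬VH; a formalisation bounce that shows the exponent
shape wrong is repaired by
`--restate` with the shape the ℝ-proof yields (closes re-certified; the arithmetic tolerates any
(n+2)^{O(√n)}·2^{O(√n)} budget).
Mooted by: VH elsewhere; superseded (not killed) if NewtonFrames/NewtonUnitEquations prove
NewtonTauWeak, or if a Dutta SOS-τ route
lands first.

NOT DECOMPOSED YET. The fg + 1 problem (k = 2, m = 2: is Z_ℝ(fg+1) = O(t)? open since Koiran 2011;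
KPT15 §1; Dutta2021 §1.1) — the calibration rung,
NOT a consequence of X1 (Descartes already gives 2t²+1 there), hence not an item; KPT's
exponent-free regime Σ c_i Π_j f_j^{α_ij}
with SHARED sparse factors (a theorem, t^{O(mk²/2)}); the Briquel–Bürgisser average case; Hrubeš's
complex-root equidistribution
reformulation; the local (one dyadic scale) versus global (scale-count) split of X1 described in the
Two-layer plan; the uniform
(∀ c ∃ C) quantitative form of RealVnTransfer. Definitions needed: none (Polynomial.roots,
support.card, tavenasV, IsPComputable,
perPoly all exist).

CHEAPEST FALSIFIER. (a) In Lean, done this session: the special cases k ≤ 1 and m ≤ 2 of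
RealTauRefined are PROVED (bc/Special.lean, from the tree's
`koiranRealTauConjecture_of_k_le_one` and `card_roots_toFinset_sumProd_sparse_le`) — the definitions
compute. (b) For refuters, one
batched kit job: maximise the number of positive zeros of f·g + 1 over 3-sparse real f, g with
exponents ≤ 40 (Descartes allows 9;
the linear conjecture predicts about 7 — the 2001 seat left exactly this fork open, CLAIMS
2026-08-07 13:14) and of c₁g₁² + c₂g₂² − g₃²
with 4-sparse g_i; any count growing like t² rather than t at m = 2 is news for the whole programme
(Dutta2021 Conj. 1 dies), any
count 2^{Ω(m)}-super-polynomial in kt at k = 2 threatens X1 itself. (c) Literature lookup already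
run: no printed ΣΠ-sparse family
beats O(kmt) real zeros (Burgisser2024Completeness §4.6; KoiranPortierTavenas2015 Thm 25 attains
k−1+ΣZ(W_j) only).

NUMBERS. Descartes/expansion: Z_ℝ ≤ 2k·t^m − 1 (tree `card_roots_toFinset_sumProd_sparse_le`); k =
1: ≤ 2m(t−1)+1 (tree); KPT15 Thm 12:
Σ_{i≤k} a_iΠ_{j≤m} f_j^{α_ij} (shared f_j) ≤ 4ktm + 4(e(1+t))^{mk²/2}; KPT15 Thm 9 constants
2,…,2,1,1 optimal (2001 seat, Thms A–C);
Dutta2021 Thm 9: ≤ 2 sparse squares ⇒ O(support) zeros; average case O(kmt)-type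
(BriquelBurgisser2020 Thm 1.1). Witness: V_n has
exactly 2^n − 1 real zeros (tree), in disjoint blocks (−4^{2u+3−N}, −4^{2u+1−N}); transfer size
(n+2)^{C(⌊√(2n+3)⌋+1)} (tree's
Prop. 3.21 constants); contradiction at n = 4^j with (n+2)^{A(⌊√(2n+3)⌋+4)} < 2^n (inline in
`closes`; also tree `exists_pow_sqrt_lt_two_pow`). Items at open: 10 (1 target, 2 cruxes,
6 supports, 1 assembly). Imports after the 2026-08-17 cone repair: TavenasHutchinsonFamily,
ValiantConjectureEquivProofs only (RealTauConjectureProofs dropped: it imported the open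
`KoiranRealTauConjecture` / `ShubSmaleTauConjecture` for nothing the route uses).

DEFINITION REQUESTS. None. (Acquisition wants filed: acq-06628 Dutta2021 full text via DOI — read
meanwhile in the scanned CSR 2021 volume, galaxy
panama:466210110046231; acq-01403 DST ITCS 2021 — fetched from the LIPIcs URL as
paper:url-6069239b0ed6.)

Novelty: Searches (2026-08-17): `lit search --hybrid "real tau conjecture sums of products sparse polynomials
real roots"` (12 book hits, none
specific); `lit search … --source zbmath` (5: KPT15, BriquelBurgisser2020, KPTT, GKPS11, Jindal et
al. 2020 random sparse);
`--source crossref --year-from 2018` (15; relevant: BriquelBurgisser2020, Dutta2021); `--source s2`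
(15; + Hrubeš ECCC 2012 note,
Ergür–Telek–Tonelli-Cueto 2023 random sparse systems); `lit galaxy search "real tau-conjecture"
--star all` (3; the CSR 2021 volume
read for Dutta2021 §1–§6); frontier.json of the summit (60 rows since 2023: 0 on real τ);
Tavenas2014 pp. 47–54 and KPT15 read on the
page; tree grep of all 69 Theses + 19 Ideas for real-zero counting (hits: TauConst decoration, card
lacunary-symmetroid-descartes).
Nearest prior art found: Tavenas2014 Conj. 3.23/3.24, Lemme 3.26, Thm 3.38 (the crux and the
transfer, verbatim programme);
Koiran2011 §6 Conj. 3; Dutta2021 (depth-2 SOS twin, same witness); in-tree: route TauConst (TauReal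
unranked, recommended this
sibling), card lacunary-symmetroid-descartes (open, unrouted: replaces depth reduction by VBP +
symmetric determinantal
representations and bets on a matrix Descartes rule for lacunary symmetric pencils — different
reduction, different counted object).
Delta: none claimed over print — this is the printed Koiran–Tavenas line re-typed crux-only into
today's Statement with the weakest
sufficient real-zero bound (Conj. 3.23 shape, not Koiran's), the V_n witness w  [refs: BriquelBurgisser2020, Dutta2021, Tavenas2014, Koiran2011]

Barriers (technique_class: real-root-counting, fewnomials, depth-four-transfer): - technique_class: real-root-counting, fewnomials, depth-four-transfer
- Literature.Barriers.ValiantsHypothesis.TauRealZeros: evaded by construction and by the catalogued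
evasion (Koiran2011 §6, "definitely not given as sums of products of sparse polynomials"): every
real-zero statement here quantifies over ΣΠ-sparse EXPRESSIONS of given (k,m,t), never over circuit
size τ; Chebyshev T_{2^k} (the barrier's witness, `tauRealZeros_holds`) has no known ΣΠ-sparse
expression below Descartes' budget, and every known real-zero explosion squares intermediate
results, which depth-4 expressions of size 2^{o(n)} cannot iterate.
- Literature.Barriers.ValiantsHypothesis.DepthReductionChasm: ENGAGED, consistently: Tavenas'
reduction is used only upward (VP ⇒ ΣΠ^{[√d]}ΣΠ^{[√d]} of size 2^{O(√n log n)}, proved in tree); the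
crux must then certify 2^n − 1 > 2^{O(√n log n)}, i.e. live exactly in the chasm gap, which the
witness's real-rootedness supplies; conceded: X1 implies that NO VP family has Kronecker images with
2^{ω(√d log n)} real zeros — a global claim about VP that the Kumar–Saraf tight families must (and
are not known not to) respect.
- Literature.Barriers.ValiantsHypothesis.AlgebraicNaturalProofs: formally outside the class — "≥ 2^n
− 1 distinct real zeros after Kronecker substitution" is a semialgebraic, not algebraic, property of
coefficient vectors, and it is applied to ONE VNP witness, not as a distinguisher vanishing on VP;
conceded that constructivity/largeness of real-zero p

History (route lifecycle, newest last):
- 2026-08-17T05:42:08Z · rev 2: restated PowersImpliesRefined (stmt-ValiantsHypothesis-18104) — unused-crux repair (rrepair-…-unu-0f365fd0): RealTauPowers (auto-crux r9; the planner filed it [support]) is an equivalent NORMAL FORM of the rank-2 crux RealTa (planner-rrepair-ValiantsHypothesis-RealTau-unu-0f365fd0-0)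
- 2026-08-17T05:42:08Z · rev 2: dropped RealTauPowers — unused-crux repair (rrepair-…-unu-0f365fd0): RealTauPowers (auto-crux r9; the planner filed it [support]) is an equivalent NORMAL FORM of the rank-2 crux RealTa (planner-rrepair-ValiantsHypothesis-RealTau-unu-0f365fd0-0)
- 2026-08-24T13:28:29Z · DORMANT — reconciler: no traction for 6.8 d (last activity item-evidence-added at 2026-08-17T17:30:36Z); parked, not closed — `ledger route dormant route-ValiantsHypothes (operator:999:852152)
- 2026-08-26T06:37:04Z · REACTIVATED — reconciler: reactivated — activity item-proof-filed at 2026-08-26T05:43:07Z after parking at 2026-08-24T13:28:29Z (operator:999:647644)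
- 2026-08-29T19:43:32Z · DORMANT — census g0: costume|duplicate of —; reader census-reader-27-g0 (operator:999:1822919)

sub-problem: ValiantsHypothesis · status: dormant · opened planner-plan-lens3-ValiantsHypothesis-resurrect-0 2026-08-17T02:21:04Z · rev 3 · ledger route-ValiantsHypothesis-RealTau
GENERATED by the gate from the ledger (D-0016/17). Provers cite these decls: `theorem foo : Summit.ValiantsHypothesis.ValiantsHypothesis.Theses.RealTau.<Decl> := …` in Summits/ValiantsHypothesis/ValiantsHypothesis/Theorems/<Name>.lean.
-/

namespace Summit.ValiantsHypothesis.ValiantsHypothesis.Theses.RealTau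

open scoped BigOperators Topology Manifold Classical MeasureTheory ProbabilityTheory Matrix InnerProductSpace ComplexConjugate ContinuousMap
open Filter Set Function TopologicalSpace MeasureTheory

attribute [summit_statement] _root_.ValiantsHypothesis

open Literature.PNP

/-- item stmt-ValiantsHypothesis-18100 · target · rank 0 · open · by planner
why it might fail: V_n's multilinear lift is a rank-one Ising partition function Σ_σ 4^{-(Σ 2^j σ_j)²}·(monomials); a Hubbard–Stratonovich/Gauss-sum identity with poly(n) nodes would put it in VP and give exactly such representations.
sources: Tavenas2014, Dutta2021, Kurtz1992, Hutchinson1923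
[target] infinitely often in n, Tavenas' V_n is NOT a real sum of k products of m t-sparse
polynomials with k, t ≤ (n+2)^{C(⌊√(2n+3)⌋+1)}, m ≤ C(⌊√(2n+3)⌋+1), for every C — an explicit
sparse-depth-four lower bound for one all-real-rooted P-definable family (weakest V_n-specific
statement the deciding theorem consumes; implied by RealTauRefined, support RefinedImpliesHard). -/
@[route_item "route-ValiantsHypothesis-RealTau"]
def VnSparseHard : Prop :=
  ∀ C n₀ : ℕ, ∃ n : ℕ, n₀ ≤ n ∧ ∀ (k m t : ℕ) (g : Fin k → Fin m → Polynomial ℝ), k ≤ (n + 2) ^ (C * (Nat.sqrt (2 * n + 3) + 1)) → m ≤ C * (Nat.sqrt (2 * n + 3) + 1) → t ≤ (n + 2) ^ (C * (Nat.sqrt (2 * n + 3) + 1)) → (∀ i j, (g i j).support.card ≤ t) → (∑ i, ∏ j, g i j) ≠ (Literature.Computability.AlgebraicComplexity.tavenasV n).map (Int.castRingHom ℝ)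

/-- item stmt-ValiantsHypothesis-18101 · crux · rank 2 · open · by planner
why it might fail: No tool beats Descartes once k ≥ 2: Wronskians give t^{O(mk²)} (KPT15 Thm 12), fewnomials 2^{O((kmt)²)}; even Z(fg+1)=O(t) is open (Chattopadhyay/Koiran/Dutta); one ΣΠ-sparse family with t^{Ω(m)} real zeros, or V_n's lift in VP, kills it.
sources: Tavenas2014, Koiran2011, KoiranPortierTavenas2015, BriquelBurgisser2020, Burgisser2024Completeness, Dutta2021
[crux] Tavenas' refined real τ-conjecture (Conj. 3.23): the number of distinct real zeros of a
nonzero Σ_{i<k}Π_{j<m} f_ij, f_ij ∈ ℝ[X] t-sparse, is ≤ 2^{a(m+1)}(k+t+2)^a for an absolute a —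
"beat Descartes' 2k·t^m by decoupling m from t"; equivalent (Lemme 3.26, Fischer) to the powers form
RealTauPowers; implied by Koiran's form TauReal (support OfKoiran, proved in Sketch). [difficulty:
open-problem] -/
@[route_item "route-ValiantsHypothesis-RealTau", crux]
def RealTauRefined : Prop :=
  ∃ a : ℕ, ∀ (k m t : ℕ) (f : Fin k → Fin m → Polynomial ℝ), (∀ i j, (f i j).support.card ≤ t) → (∑ i, ∏ j, f i j) ≠ 0 → (∑ i, ∏ j, f i j).roots.toFinset.card ≤ 2 ^ (a * (m + 1)) * (k + t + 2) ^ a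

/-- item stmt-ValiantsHypothesis-18102 · crux · rank 3 · closed · proved by Summit.ValiantsHypothesis.ValiantsHypothesis.Theorems.RealTauRealVnTransfer.realVnTransfer_proof @ 59f140a5f65b (prover) · by planner
why it might fail: Published but unformalised: needs per ∈ VP_ℂ ⇒ per ∈ VP_ℝ (realification of weighted-sum gates, in neither tree nor thesis text) and the tree's depth-4 reduction re-run for `complexity` over ℝ; a shape mismatch in the exponent C(⌊√(2n+3)⌋+1) forces a restatement.
sources: Tavenas2014, Koiran2011, Literature.Computability.AlgebraicComplexity.exists_sps_of_isProjection_perPoly, Literature.Computability.AlgebraicComplexity.Tavenas2014_cor_3_37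
[crux] with-constants Koiran–Tavenas transfer for V_n (Tavenas2014 Thm 3.38 via Cor. 3.37 and Prop.
3.21): if (per_n) is p-computable over ℂ then for some C every V_n equals, in ℝ[X], a sum of k ≤
(n+2)^{C(⌊√(2n+3)⌋+1)} products of m ≤ C(⌊√(2n+3)⌋+1) polynomials with ≤ (n+2)^{C(⌊√(2n+3)⌋+1)}
monomials — realification of constants + the tree's PROVED constant-free depth-four route re-run
over ℝ. A consequence of VH (vacuous antecedent) used toward VH. [difficulty: L] -/
@[route_item "route-ValiantsHypothesis-RealTau", crux]
def RealVnTransfer : Prop :=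
  Literature.Computability.AlgebraicComplexity.IsPComputable (fun n => Literature.Computability.AlgebraicComplexity.perPoly (Fin n) ℂ) → ∃ C : ℕ, ∀ n : ℕ, ∃ (k m t : ℕ) (g : Fin k → Fin m → Polynomial ℝ), k ≤ (n + 2) ^ (C * (Nat.sqrt (2 * n + 3) + 1)) ∧ m ≤ C * (Nat.sqrt (2 * n + 3) + 1) ∧ t ≤ (n + 2) ^ (C * (Nat.sqrt (2 * n + 3) + 1)) ∧ (∀ i j, (g i j).support.card ≤ t) ∧ (∑ i, ∏ j, g i j) = (Literature.Computability.AlgebraicComplexity.tavenasV n).map (Int.castRingHom ℝ)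

-- `RealVnTransfer` holds: proved by `Summit.ValiantsHypothesis.ValiantsHypothesis.Theorems.RealTauRealVnTransfer.realVnTransfer_proof` @ 59f140a5f65b (its module imports this route file, so no `_holds` link can be stated here).

/-- item stmt-ValiantsHypothesis-0358 · crux (kind.auto-crux: conjecture-grade) · rank 9 · open · by planner
why it might fail: auto-crux — conjecture-grade statement (docstring avows it ('conjecture')); it is open, so it may simply be false
sources: Koiran2011, Tavenas2014, Burgisser2024Completeness
[Koiran2011 Conj 1]: the number of distinct real roots of a nonzero Σ_{i<k} Π_{j<m} f_ij with each
f_ij t-sparse is polynomial in k, m, t. Koiran2011 Thm: real τ-conjecture ⇒ per ∉ VP⁰ (so it can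
replace tau_conjecture in the assembly, still needing tau_const_elim). Real algebraic geometry
input: Descartes/Khovanskii fewnomial bounds give only exponential in m·t; Wronskian methods
(Koiran–Portier–Tavenas) give partial cases. -/
@[route_item "route-ValiantsHypothesis-RealTau"]
def TauReal : Prop :=
  ∃ c : ℕ, ∀ (k m t : ℕ) (f : Fin k → Fin m → Polynomial ℝ), (∀ i j, (f i j).support.card ≤ t) → (∑ i, ∏ j, f i j) ≠ 0 → (∑ i, ∏ j, f i j).roots.toFinset.card ≤ (k + m + t + 2) ^ c

-- earlier PowersImpliesRefined (stmt-ValiantsHypothesis-18104, replaced 2026-08-17T05:42:08Z -> stmt-ValiantsHypothesis-17933): retired by None — RealTauPowers → RealTauRefined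
/-- item stmt-ValiantsHypothesis-17933 · support · rank 9 · closed · proved by Summit.ValiantsHypothesis.ValiantsHypothesis.Theorems.PowersImpliesRefined_proof @ 9b7655b7913a (prover) · by planner
sources: Tavenas2014
[support] Fischer/polarisation step of Tavenas2014 Lemme 3.26, stated SELF-CONTAINED: IF for one
absolute a every nonzero Σ_{i<k} c_i·f_i^{α_i} (f_i ∈ ℝ[X] t-sparse, α_i ≤ m, c_i ∈ ℝ) has ≤
2^{a(m+1)}(k+t+2)^a distinct real zeros (the refined POWERS normal form, Tavenas2014 Conj. 3.24 with
signed coefficients — formerly the separate item RealTauPowers, dropped 2026-08-17 as outside the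
deciding theorem's cone; the antecedent here is its statement verbatim), THEN RealTauRefined. On
paper: m!·Π_{j<m} y_j = Σ_{S⊆[m]} (−1)^{m−|S|}(Σ_{j∈S} y_j)^m rewrites Σ_{i<k}Π_{j<m} f_ij as k·2^m
signed m-th powers (c = ±1/m!) of (mt)-sparse polynomials, and 2^{a(m+1)}(k·2^m+mt+2)^a ≤
2^{3a(m+1)}(k+t+2)^{3a} re-absorbs the bound (a' = 3a; m = 0 corner: F constant, no zeros). A proof
of the antecedent (the Wronskian-friendly normal form: one sparse polynomial per term) therefore
closes the rank-2 crux through this item. [difficulty: M — textbook identity + Fin k × Finset (Fin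
m) reindexing, ~150 lines; Mathlib has no ready-made product polarisation lemma] -/
@[route_item "route-ValiantsHypothesis-RealTau"]
def PowersImpliesRefined : Prop :=
  (∃ a : ℕ, ∀ (k m t : ℕ) (c : Fin k → ℝ) (f : Fin k → Polynomial ℝ) (α : Fin k → ℕ), (∀ i, (f i).support.card ≤ t) → (∀ i, α i ≤ m) → (∑ i, Polynomial.C (c i) * f i ^ α i) ≠ 0 → (∑ i, Polynomial.C (c i) * f i ^ α i).roots.toFinset.card ≤ 2 ^ (a * (m + 1)) * (k + t + 2) ^ a) → RealTauRefined

-- `PowersImpliesRefined` holds: proved by `Summit.ValiantsHypothesis.ValiantsHypothesis.Theorems.PowersImpliesRefined_proof` @ 9b7655b7913a (its module imports this route file, so no `_holds` link can be stated here).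

/-- item stmt-ValiantsHypothesis-18105 · support · rank 9 · closed · proved by Summit.ValiantsHypothesis.ValiantsHypothesis.Theorems.RealTau.ofKoiran_proof (prover) · by planner
sources: Tavenas2014
[support] Koiran's form implies Tavenas' refined form ((k+m+t+2)^c ≤ 2^{c(m+1)}(k+t+2)^c) — PROVED
in the planner's Sketch.lean (`ofKoiran_proof`, 8 lines); lands with the route's first Theorems
file. [difficulty: provable-now] -/
@[route_item "route-ValiantsHypothesis-RealTau"]
def OfKoiran : Prop :=
  TauReal → RealTauRefined

-- `OfKoiran` holds: proved by `Summit.ValiantsHypothesis.ValiantsHypothesis.Theorems.RealTau.ofKoiran_proof` (its module imports this route file, so no `_holds` link can be stated here).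

/-- item stmt-ValiantsHypothesis-18106 · support · rank 9 · closed · proved by Summit.ValiantsHypothesis.ValiantsHypothesis.Theorems.SymmetroidDescartes.isPComputable_perPoly_real_of_complex @ 9f0b56d73a9e (prover) · by planner
sources: Burgisser2000, Tavenas2014
[support] p-computability of (per_n) over ℂ implies p-computability over ℝ (simulate each complex
weighted-sum / product gate by O(1) real gates on real and imaginary parts; per_n has real
coefficients) — the first half of RealVnTransfer. [difficulty: M] -/
@[route_item "route-ValiantsHypothesis-RealTau"]
def Realification : Prop :=
  Literature.Computability.AlgebraicComplexity.IsPComputable (fun n => Literature.Computability.AlgebraicComplexity.perPoly (Fin n) ℂ) → Literature.Computability.AlgebraicComplexity.IsPComputable (fun n => Literature.Computability.AlgebraicComplexity.perPoly (Fin n) ℝ)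

/-- `Realification` holds: proved by `Summit.ValiantsHypothesis.ValiantsHypothesis.Theorems.SymmetroidDescartes.isPComputable_perPoly_real_of_complex` @ 9f0b56d73a9e. -/
theorem Realification_holds : Realification := _root_.Summit.ValiantsHypothesis.ValiantsHypothesis.Theorems.SymmetroidDescartes.isPComputable_perPoly_real_of_complex

/-- item stmt-ValiantsHypothesis-18107 · support · rank 9 · closed · proved by Summit.ValiantsHypothesis.ValiantsHypothesis.Theorems.RealTau.refinedImpliesHard_proof (prover) · by planner
sources: Tavenas2014, Literature.Computability.AlgebraicComplexity.exists_pow_sqrt_lt_two_pow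
[support] the refined real τ-conjecture gives the target: any ΣΠ-sparse expression of Tavenas size C
at level n has ≤ (n+2)^{a(2C+3)(⌊√(2n+3)⌋+4)} real zeros, fewer than V_n's 2^n − 1 for infinitely
many n (growth lemma `exists_pow_sqrt_lt_two_pow` strengthened to arbitrarily large n). [difficulty:
provable-now] -/
@[route_item "route-ValiantsHypothesis-RealTau"]
def RefinedImpliesHard : Prop :=
  RealTauRefined → VnSparseHard

-- `RefinedImpliesHard` holds: proved by `Summit.ValiantsHypothesis.ValiantsHypothesis.Theorems.RealTau.refinedImpliesHard_proof` (its module imports this route file, so no `_holds` link can be stated here).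

/-- item stmt-ValiantsHypothesis-18108 · assembly · rank 1 · closed · proved by Summit.ValiantsHypothesis.ValiantsHypothesis.Theorems.RealTau.assembly_proof (prover) · by planner
sources: Tavenas2014, Literature.Computability.AlgebraicComplexity.perNotPComputableComplex_iff_holds
[assembly] VnSparseHard → RealVnTransfer → ValiantsHypothesis (pure logic over
`perNotPComputableComplex_iff_holds`; proved in Sketch.lean). -/
@[route_item "route-ValiantsHypothesis-RealTau"]
def Assembly : Prop :=
  VnSparseHard → RealVnTransfer → ValiantsHypothesis

-- `Assembly` holds: proved by `Summit.ValiantsHypothesis.ValiantsHypothesis.Theorems.RealTau.assembly_proof` (its module imports this route file, so no `_holds` link can be stated here).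

/-! D-0027 §2.1 — DECIDING THEOREM (planner-authored via `route open/edit --closes-file`; by planner-rrepair-ValiantsHypothesis-RealTau-c9a7c941-0 2026-08-17T02:37:14Z):
its hypotheses are this route's items and its conclusion the sub-problem Statement (glue_lint), and it elaborates with this file. -/

@[closes "route-ValiantsHypothesis-RealTau"] theorem closes (h_RealTauRefined : RealTauRefined) (h_RealVnTransfer : RealVnTransfer) :
    ValiantsHypothesis := by
  show Literature.Computability.AlgebraicComplexity.VP ℂ ≠
    Literature.Computability.AlgebraicComplexity.VNP ℂ
  rw [← Literature.Computability.AlgebraicComplexity.perNotPComputableComplex_iff_holds]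
  intro hP
  obtain ⟨a, ha⟩ := h_RealTauRefined
  obtain ⟨C, hC⟩ := h_RealVnTransfer hP
  -- GROWTH, self-contained over Mathlib (no Literature import): for every `d` some `m ≥ 1` has
  -- `(m + 2)^d < 2^m` (polynomial loses against exponential), hence for every `A` some
  -- `n = 4^j` has `(n + 2)^{A (⌊√(2n+3)⌋ + 4)} < 2^n` (quasi-polynomial `2^{O(√n log n)}` loses
  -- against `2^n`; Tavenas 2014, proof of Thm. 3.3, p. 47).
  have poly_lt_exp : ∀ d : ℕ, ∃ m : ℕ, 1 ≤ m ∧ (m + 2) ^ d < 2 ^ m := by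
    intro d
    have ht := tendsto_pow_const_div_const_pow_of_one_lt d (show (1 : ℝ) < 2 by norm_num)
    have hev : ∀ᶠ n : ℕ in atTop, (n : ℝ) ^ d / 2 ^ n < 1 / 4 :=
      ht.eventually (gt_mem_nhds (by norm_num))
    obtain ⟨N, hN⟩ := eventually_atTop.1 hev
    refine ⟨max N 3 - 2, by omega, ?_⟩
    set n₀ := max N 3 with hn₀
    have hn₀2 : 2 ≤ n₀ := by omega
    have h1 : (n₀ : ℝ) ^ d / 2 ^ n₀ < 1 / 4 := hN n₀ (le_max_left _ _)
    have h2 : (n₀ : ℝ) ^ d < 2 ^ (n₀ - 2) := by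
      rw [div_lt_iff₀ (by positivity)] at h1
      have : (2 : ℝ) ^ n₀ = 2 ^ (n₀ - 2) * 4 := by
        rw [show n₀ = (n₀ - 2) + 2 from by omega, pow_add]
        norm_num
      linarith
    have h3 : n₀ - 2 + 2 = n₀ := by omega
    rw [h3]
    exact_mod_cast h2
  have growth : ∀ A : ℕ, ∃ n : ℕ, (n + 2) ^ (A * (Nat.sqrt (2 * n + 3) + 4)) < 2 ^ n := by
    intro A
    obtain ⟨j, hj1, hj⟩ := poly_lt_exp (8 * A + 1)
    -- `4 (2j+1) A < 2^j`
    have key : 4 * (2 * j + 1) * A < 2 ^ j := by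
      have h1 : 8 * A ≤ (j + 2) ^ (8 * A) :=
        ((Nat.lt_two_pow_self).le).trans (Nat.pow_le_pow_left (by omega) _)
      calc 4 * (2 * j + 1) * A ≤ (j + 2) * (8 * A) := by nlinarith
        _ ≤ (j + 2) * (j + 2) ^ (8 * A) := Nat.mul_le_mul_left _ h1
        _ = (j + 2) ^ (8 * A + 1) := (pow_succ' _ _).symm
        _ < 2 ^ j := hj
    refine ⟨4 ^ j, ?_⟩
    have h4 : 4 ^ j = 2 ^ j * 2 ^ j := by
      rw [show (4 : ℕ) = 2 * 2 from rfl, mul_pow]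
    -- `⌊√(2·4^j+3)⌋ ≤ 2^{j+1}`
    have hsq : Nat.sqrt (2 * 4 ^ j + 3) ≤ 2 ^ (j + 1) := by
      have hle : 2 * 4 ^ j + 3 ≤ (2 ^ (j + 1)) ^ 2 := by
        have : (2 ^ (j + 1)) ^ 2 = 4 * 4 ^ j := by
          rw [← pow_mul, show (j + 1) * 2 = 2 * j + 2 from by ring, pow_add, pow_mul,
            show (2 : ℕ) ^ 2 = 4 from rfl]; ring
        rw [this]
        have hj4 : 4 ≤ 4 ^ j := by
          calc 4 = 4 ^ 1 := (pow_one 4).symm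
            _ ≤ 4 ^ j := Nat.pow_le_pow_right (by norm_num) hj1
        omega
      calc Nat.sqrt (2 * 4 ^ j + 3) ≤ Nat.sqrt ((2 ^ (j + 1)) ^ 2) := Nat.sqrt_le_sqrt hle
        _ = 2 ^ (j + 1) := Nat.sqrt_eq' _
    -- exponent `≤ A · 2^{j+2}`
    have hE : A * (Nat.sqrt (2 * 4 ^ j + 3) + 4) ≤ A * 2 ^ (j + 2) := by
      refine Nat.mul_le_mul_left A ?_
      have : 2 ^ (j + 2) = 2 ^ (j + 1) + 2 ^ (j + 1) := by rw [pow_succ]; ring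
      have h4' : 4 ≤ 2 ^ (j + 1) := by
        have h2j : 2 ≤ 2 ^ j := by
          calc 2 = 2 ^ 1 := (pow_one 2).symm
            _ ≤ 2 ^ j := Nat.pow_le_pow_right (by norm_num) hj1
        rw [pow_succ]; omega
      omega
    -- base `≤ 2^{2j+1}`
    have hB : 4 ^ j + 2 ≤ 2 ^ (2 * j + 1) := by
      have : 2 ^ (2 * j + 1) = 2 * 4 ^ j := by rw [pow_succ, pow_mul]; norm_num; ring
      rw [this]
      have hj4 : 4 ≤ 4 ^ j := by
        calc 4 = 4 ^ 1 := (pow_one 4).symm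
          _ ≤ 4 ^ j := Nat.pow_le_pow_right (by norm_num) hj1
      omega
    calc (4 ^ j + 2) ^ (A * (Nat.sqrt (2 * 4 ^ j + 3) + 4))
        ≤ (2 ^ (2 * j + 1)) ^ (A * (Nat.sqrt (2 * 4 ^ j + 3) + 4)) := Nat.pow_le_pow_left hB _
      _ ≤ (2 ^ (2 * j + 1)) ^ (A * 2 ^ (j + 2)) := Nat.pow_le_pow_right (Nat.two_pow_pos _) hE
      _ = 2 ^ ((2 * j + 1) * (A * 2 ^ (j + 2))) := by rw [← pow_mul]
      _ < 2 ^ 4 ^ j := Nat.pow_lt_pow_right (by norm_num) ?_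
    calc (2 * j + 1) * (A * 2 ^ (j + 2)) = 4 * (2 * j + 1) * A * 2 ^ j := by rw [pow_add]; ring
      _ < 2 ^ j * 2 ^ j := Nat.mul_lt_mul_of_pos_right key (Nat.two_pow_pos j)
      _ = 4 ^ j := h4.symm
  -- the bad `n`
  obtain ⟨n, hn⟩ := growth (a * (2 * C + 3) + 1)
  obtain ⟨k, m, t, g, hk, hm, ht, hg, hsum⟩ := hC n
  have hne : (∑ i, ∏ j, g i j) ≠ 0 := by
    rw [hsum]; exact Literature.Computability.AlgebraicComplexity.map_tavenasV_ne_zero _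
  have hroots := ha k m t g hg hne
  rw [hsum] at hroots
  -- `2^n - 1 ≤ Z_ℝ(V_n) ≤ 2^{a(m+1)} (k+t+2)^a` (all roots of `V_n` are real: Hutchinson/Kurtz)
  replace hroots :=
    (Literature.Computability.AlgebraicComplexity.le_card_roots_toFinset_map_tavenasV n).trans hroots
  -- bookkeeping: `2^{a(m+1)} (k+t+2)^a ≤ (n+2)^{a(2C+3)(s+4)}`, `s = ⌊√(2n+3)⌋`
  set s : ℕ := Nat.sqrt (2 * n + 3) with hs
  set E : ℕ := C * (s + 1) with hE
  have hB : 2 ≤ n + 2 := by omega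
  have hB1 : 1 ≤ (n + 2) ^ E := Nat.one_le_pow _ _ (by omega)
  have h2pow : 2 ^ (a * (m + 1)) ≤ (n + 2) ^ (a * (E + 1)) :=
    calc 2 ^ (a * (m + 1)) ≤ (n + 2) ^ (a * (m + 1)) := Nat.pow_le_pow_left hB _
      _ ≤ (n + 2) ^ (a * (E + 1)) :=
          Nat.pow_le_pow_right (by omega) (Nat.mul_le_mul_left a (by omega))
  have hkt : k + t + 2 ≤ (n + 2) ^ (E + 2) := by
    have h4 : 4 ≤ (n + 2) ^ 2 :=
      calc 4 = 2 ^ 2 := by norm_num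
        _ ≤ (n + 2) ^ 2 := Nat.pow_le_pow_left hB 2
    calc k + t + 2 ≤ 4 * (n + 2) ^ E := by omega
      _ ≤ (n + 2) ^ 2 * (n + 2) ^ E := Nat.mul_le_mul_right _ h4
      _ = (n + 2) ^ (E + 2) := by rw [← pow_add, Nat.add_comm 2 E]
  have hkta : (k + t + 2) ^ a ≤ (n + 2) ^ (a * (E + 2)) :=
    calc (k + t + 2) ^ a ≤ ((n + 2) ^ (E + 2)) ^ a := Nat.pow_le_pow_left hkt a
      _ = (n + 2) ^ (a * (E + 2)) := by rw [← pow_mul, mul_comm]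
  have hexp : a * (E + 1) + a * (E + 2) ≤ a * (2 * C + 3) * (s + 4) := by
    have : (E + 1) + (E + 2) ≤ (2 * C + 3) * (s + 4) := by rw [hE]; nlinarith
    calc a * (E + 1) + a * (E + 2) = a * ((E + 1) + (E + 2)) := by ring
      _ ≤ a * ((2 * C + 3) * (s + 4)) := Nat.mul_le_mul_left a this
      _ = a * (2 * C + 3) * (s + 4) := by ring
  have key : 2 ^ n - 1 ≤ (n + 2) ^ (a * (2 * C + 3) * (s + 4)) :=
    calc 2 ^ n - 1 ≤ 2 ^ (a * (m + 1)) * (k + t + 2) ^ a := hroots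
      _ ≤ (n + 2) ^ (a * (E + 1)) * (n + 2) ^ (a * (E + 2)) := Nat.mul_le_mul h2pow hkta
      _ = (n + 2) ^ (a * (E + 1) + a * (E + 2)) := by rw [← pow_add]
      _ ≤ (n + 2) ^ (a * (2 * C + 3) * (s + 4)) := Nat.pow_le_pow_right (by omega) hexp
  -- the extra factor `(n + 2)^{s + 4} ≥ 2` in `hn` absorbs the `- 1`
  have hsplit : (n + 2) ^ ((a * (2 * C + 3) + 1) * (s + 4)) =
      (n + 2) ^ (a * (2 * C + 3) * (s + 4)) * (n + 2) ^ (s + 4) := by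
    rw [← pow_add]; congr 1; ring
  have h2le : 2 ≤ (n + 2) ^ (s + 4) :=
    calc 2 ≤ n + 2 := hB
      _ ≤ (n + 2) ^ (s + 4) := Nat.le_self_pow (by omega) _
  have hLY : 2 * (n + 2) ^ (a * (2 * C + 3) * (s + 4)) ≤
      (n + 2) ^ ((a * (2 * C + 3) + 1) * (s + 4)) := by
    rw [hsplit, mul_comm]
    exact Nat.mul_le_mul_left _ h2le
  have h1P : 1 ≤ 2 ^ n := Nat.one_le_two_pow
  have h1Y : 1 ≤ (n + 2) ^ (a * (2 * C + 3) * (s + 4)) := Nat.one_le_pow _ _ (by omega)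
  have h1L : 1 ≤ (n + 2) ^ ((a * (2 * C + 3) + 1) * (s + 4)) := Nat.one_le_pow _ _ (by omega)
  omega

end Summit.ValiantsHypothesis.ValiantsHypothesis.Theses.RealTau
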